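import Literature.Geometry.Kaehler.ComplexTorusLefschetzGroupConnectedLowDimension
import Literature.Geometry.Kaehler.ComplexTorusAlbertTypeIVLefschetzGroupConnected
import HarnessLib

/-!
# «`S(X)` is connected iff `X` has no isogeny factor of type III»: Milne's Summary table assembled for all four
# Albert types — for every simple polarised complex torus sorted into an Albert type (all of them for `g ≤ 7`),
# `Lf(X)(ℂ) = S(X)(ℂ) ⟺ X` is not of type III; and the isogeny-product form

Layer `Literature/Geometry/Kaehler`, namespace `Literature.Geometry.Kaehler.ComplexTorus`; lane `lit-hodgefound`
(Track 2 foundations library), Layer A4 (Lefschetz groups), skeleton seat `lit-hodgefound-skel-4` (generation 35),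
row A4-94 (f) = GAP row A4-90's assembly, now with p36's type IV (every `d`). Sequel BY NAME of
`ComplexTorusLefschetzGroupConnectedAlbertTypes` / `…LowDimension` (rows A4-94 (d)(e)), of p36's
`IsSimple.lefschetzIdentityC_eq_lefschetzGroupC_of_isAlbertTypeIV` (type IV, every `d`), `…_of_isAlbertTypeII`, of
rows A4-88/A4-89 (`IsSimple.lefschetzIdentityC_lt_lefschetzGroupC_of_isAlbertTypeIII`,
`IsIsogenous.lefschetzIdentityC_eq_lefschetzGroupC_iff_of_powers`) and of p12's Albert theorem for `g ≤ 7`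
(`IsSimple.isAlbertType_of_finrank_le_seven`). THEOREMS ONLY (no definition, no named fact; net debt 0).

## Sources, verbatim

* [Milne1999LefschetzClasses] J. S. Milne, *Lefschetz classes on abelian varieties*, Duke Math. J. 96 (1999), §2
  Summary (p. 652): «Type ∣ Group ∣ Semisimple ∣ Connected […] I ∣ Sp ∣ Yes ∣ Yes; II ∣ Sp ∣ Yes ∣ Yes; III ∣ O ∣ Yes ∣
  No; IV ∣ GL ∣ No ∣ Yes»; §1 Prop. 1.5; Remark 4.9 (p. 661): «When `A` has an isogeny factor of type III […]».
* [Lange2023AbelianVarietiesComplex] H. Lange, *Abelian Varieties over the Complex Numbers* (2023), Thm. 2.6.5 / 2.6.8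
  (Albert's classification), §7.2.4 Exercise (4).

## What is proved

* `IsSimple.lefschetzIdentityC_eq_lefschetzGroupC_iff_not_isAlbertTypeIII_of_isAlbertType` — for a simple polarised
  torus of Albert type I, II, III or IV (any `g`, any `d`): `Lf = S ⟺ ¬` type III.
* **`IsSimple.lefschetzIdentityC_eq_lefschetzGroupC_iff_not_isAlbertTypeIII'`** — the same for every simple polarised
  torus of dimension `g ≤ 7` (Albert's theorem in the tree), no further hypothesis.
* **`IsIsogenous.lefschetzIdentityC_eq_lefschetzGroupC_iff_forall_not_isAlbertTypeIII_of_powers'`** — for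
  `X ∼ ∏ B_k^{n_k}` with simple factors of dimension `≤ 7`: `Lf(X)(ℂ) = S(X)(ℂ) ⟺` no `B_k` is of type III.
-/

noncomputable section

open Matrix Module
open Literature.RingTheory.CentralSimple (IsAlbertTypeI IsAlbertTypeII IsAlbertTypeIII IsAlbertTypeIV)

namespace Literature.Geometry.Kaehler

namespace ComplexTorus

/-! ## §1 Simple tori -/

section Simple

variable {κ : Type} [Fintype κ] [DecidableEq κ] [Nonempty κ] {E : Type*} [NormedAddCommGroup E] [NormedSpace ℂ E]
  {Ψ : (κ → ℝ) ≃L[ℝ] E} {η : E [⋀^Fin 2]→L[ℝ] ℝ} {G : Matrix κ κ ℚ}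

/-- **Milne's table, all four rows: for a simple polarised complex torus of Albert type I, II, III or IV,
`Lf(X)(ℂ) = S(X)(ℂ)` iff the type is not III.** [cite: Milne1999LefschetzClasses, §2 Summary table (p. 652: «I … Yes; II … Yes; III … No; IV … Yes») and Remark 4.9]
[cite: Lange2023AbelianVarietiesComplex, Thm. 2.6.5 and Thm. 2.6.8] -/
theorem IsSimple.lefschetzIdentityC_eq_lefschetzGroupC_iff_not_isAlbertTypeIII_of_isAlbertType (hX : IsSimple Ψ)
    (hη : IsRiemannForm Ψ η) (hG : G.map (Rat.cast : ℚ → ℝ) = latticeGram Ψ η)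
    (h : IsAlbertTypeI (centerField Ψ hX) (endAlgRat Ψ) (rosatiEnd Ψ hη.1 hη.2.2 hG) ∨
      IsAlbertTypeII (centerField Ψ hX) (endAlgRat Ψ) (rosatiEnd Ψ hη.1 hη.2.2 hG) ∨
        IsAlbertTypeIII (centerField Ψ hX) (endAlgRat Ψ) (rosatiEnd Ψ hη.1 hη.2.2 hG) ∨
          IsAlbertTypeIV (centerField Ψ hX) (endAlgRat Ψ) (rosatiEnd Ψ hη.1 hη.2.2 hG)) :
    lefschetzIdentityC Ψ G = lefschetzGroupC Ψ G ↔
      ¬ IsAlbertTypeIII (centerField Ψ hX) (endAlgRat Ψ) (rosatiEnd Ψ hη.1 hη.2.2 hG) := by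
  refine ⟨fun he hIII ↦ (hX.lefschetzIdentityC_lt_lefschetzGroupC_of_isAlbertTypeIII hη hG hIII).ne he, fun hIII ↦ ?_⟩
  rcases h with h | h | h | h
  · exact hX.lefschetzIdentityC_eq_lefschetzGroupC_of_isAlbertTypeI hη hG h
  · exact hX.lefschetzIdentityC_eq_lefschetzGroupC_of_isAlbertTypeII hη hG h
  · exact absurd h hIII
  · exact hX.lefschetzIdentityC_eq_lefschetzGroupC_of_isAlbertTypeIV hη hG h

variable [FiniteDimensional ℂ E]

/-- **Milne's table as an unconditional equivalence for every simple polarised complex torus of dimension `g ≤ 7`: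
`Lf(X)(ℂ) = S(X)(ℂ) ⟺ X` is not of Albert type III** (Albert's theorem for `g ≤ 7` sorts `X` into a type).
[cite: Milne1999LefschetzClasses, §2 Summary table (p. 652) and Remark 4.9] [cite: Lange2023AbelianVarietiesComplex, §2.6.1 Proposition, Thm. 2.6.5, Thm. 2.6.8] -/
theorem IsSimple.lefschetzIdentityC_eq_lefschetzGroupC_iff_not_isAlbertTypeIII' (hX : IsSimple Ψ)
    (hη : IsRiemannForm Ψ η) (hG : G.map (Rat.cast : ℚ → ℝ) = latticeGram Ψ η) (hg : finrank ℂ E ≤ 7) :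
    lefschetzIdentityC Ψ G = lefschetzGroupC Ψ G ↔
      ¬ IsAlbertTypeIII (centerField Ψ hX) (endAlgRat Ψ) (rosatiEnd Ψ hη.1 hη.2.2 hG) :=
  hX.lefschetzIdentityC_eq_lefschetzGroupC_iff_not_isAlbertTypeIII_of_isAlbertType hη hG
    (hX.isAlbertType_of_finrank_le_seven hη hG hg)

/-- `g ≤ 7`, sufficiency form: a simple polarised torus not of type III has `Lf(X)(ℂ) = S(X)(ℂ)`.
[cite: Milne1999LefschetzClasses, §2 Summary table (p. 652)] -/
theorem IsSimple.lefschetzIdentityC_eq_lefschetzGroupC_of_not_isAlbertTypeIII' (hX : IsSimple Ψ)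
    (hη : IsRiemannForm Ψ η) (hG : G.map (Rat.cast : ℚ → ℝ) = latticeGram Ψ η) (hg : finrank ℂ E ≤ 7)
    (hIII : ¬ IsAlbertTypeIII (centerField Ψ hX) (endAlgRat Ψ) (rosatiEnd Ψ hη.1 hη.2.2 hG)) :
    lefschetzIdentityC Ψ G = lefschetzGroupC Ψ G :=
  (hX.lefschetzIdentityC_eq_lefschetzGroupC_iff_not_isAlbertTypeIII' hη hG hg).2 hIII

/-- `g ≤ 7`, irreducibility form: `I_ℂ(S(X)(ℂ))` is prime for a simple polarised torus not of type III.
[cite: Milne1999LefschetzClasses, §2 Summary table (p. 652)] -/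
theorem IsSimple.isPrime_vanishingIdealC_lefschetzGroupC_of_not_isAlbertTypeIII (hX : IsSimple Ψ)
    (hη : IsRiemannForm Ψ η) (hG : G.map (Rat.cast : ℚ → ℝ) = latticeGram Ψ η) (hg : finrank ℂ E ≤ 7)
    (hIII : ¬ IsAlbertTypeIII (centerField Ψ hX) (endAlgRat Ψ) (rosatiEnd Ψ hη.1 hη.2.2 hG)) :
    (vanishingIdealC (lefschetzGroupC Ψ G)).IsPrime := by
  rw [isPrime_vanishingIdealC_lefschetzGroupC_iff]
  exact hX.lefschetzIdentityC_eq_lefschetzGroupC_of_not_isAlbertTypeIII' hη hG hg hIII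

end Simple

/-! ## §2 Isogeny products: «connected iff no factor of type III» -/

section IsogenyFactors

variable {K : Type*} [Fintype K] [DecidableEq K] {σ : K → Type} [∀ k, Fintype (σ k)] [∀ k, DecidableEq (σ k)]
  [∀ k, Nonempty (σ k)] {F : K → Type*} [∀ k, NormedAddCommGroup (F k)] [∀ k, NormedSpace ℂ (F k)]
  [∀ k, FiniteDimensional ℂ (F k)] {Ψ : ∀ k, (σ k → ℝ) ≃L[ℝ] F k} {ω : ∀ k, F k [⋀^Fin 2]→L[ℝ] ℝ}
  {G : ∀ k, Matrix (σ k) (σ k) ℚ} {n : K → ℕ}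
  {ι : Type*} [Fintype ι] [DecidableEq ι] {E : Type*} [NormedAddCommGroup E] [NormedSpace ℂ E]
  {Φ : (ι → ℝ) ≃L[ℝ] E} {η : E [⋀^Fin 2]→L[ℝ] ℝ} {G₀ : Matrix ι ι ℚ}

/-- **MILNE'S REMARK 4.9 AS AN EQUIVALENCE: for `X ∼ ∏ B_k^{n_k}` with simple factors of dimension `≤ 7`,
`S(X)(ℂ)` is connected — `Lf(X)(ℂ) = S(X)(ℂ)` — iff no `B_k` is of Albert type III** (`Hom_ℚ(B_k, B_l) = 0` for
`k ≠ l`, `n_k ≥ 1`). [cite: Milne1999LefschetzClasses, §1 Prop. 1.5, §2 Summary table (p. 652) and Remark 4.9 (p. 661)]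
[cite: Lange2023AbelianVarietiesComplex, §2.6.1 Proposition] -/
theorem IsIsogenous.lefschetzIdentityC_eq_lefschetzGroupC_iff_forall_not_isAlbertTypeIII_of_powers'
    (hX : IsIsogenous Φ (sigmaPiPeriod fun k ↦ powPeriod (Ψ k) (n k))) (hη : IsRiemannForm Φ η)
    (hG₀ : G₀.map (Rat.cast : ℚ → ℝ) = latticeGram Φ η) (h : ∀ k, IsRiemannForm (Ψ k) (ω k))
    (hG : ∀ k, (G k).map (Rat.cast : ℚ → ℝ) = latticeGram (Ψ k) (ω k))
    (hhom : ∀ k l, k ≠ l → homRat (Ψ l) (Ψ k) = ⊥) (hn : ∀ k, 0 < n k) (hs : ∀ k, IsSimple (Ψ k))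
    (hg : ∀ k, finrank ℂ (F k) ≤ 7) :
    lefschetzIdentityC Φ G₀ = lefschetzGroupC Φ G₀ ↔
      ∀ k, ¬ IsAlbertTypeIII (centerField (Ψ k) (hs k)) (endAlgRat (Ψ k)) (rosatiEnd (Ψ k) (h k).1 (h k).2.2 (hG k)) := by
  rw [hX.lefschetzIdentityC_eq_lefschetzGroupC_iff_of_powers hη hG₀ h hG hhom hn]
  exact forall_congr' fun k ↦ (hs k).lefschetzIdentityC_eq_lefschetzGroupC_iff_not_isAlbertTypeIII' (h k) (hG k) (hg k)

/-- The same, sufficiency form: no simple factor of type III (dimensions `≤ 7`) ⟹ `Lf(X)(ℂ) = S(X)(ℂ)`.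
[cite: Milne1999LefschetzClasses, §1 Prop. 1.5 and §2 Summary table (p. 652)] -/
theorem IsIsogenous.lefschetzIdentityC_eq_lefschetzGroupC_of_powers_of_forall_not_isAlbertTypeIII
    (hX : IsIsogenous Φ (sigmaPiPeriod fun k ↦ powPeriod (Ψ k) (n k))) (hη : IsRiemannForm Φ η)
    (hG₀ : G₀.map (Rat.cast : ℚ → ℝ) = latticeGram Φ η) (h : ∀ k, IsRiemannForm (Ψ k) (ω k))
    (hG : ∀ k, (G k).map (Rat.cast : ℚ → ℝ) = latticeGram (Ψ k) (ω k))
    (hhom : ∀ k l, k ≠ l → homRat (Ψ l) (Ψ k) = ⊥) (hn : ∀ k, 0 < n k) (hs : ∀ k, IsSimple (Ψ k))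
    (hg : ∀ k, finrank ℂ (F k) ≤ 7)
    (hIII : ∀ k, ¬ IsAlbertTypeIII (centerField (Ψ k) (hs k)) (endAlgRat (Ψ k)) (rosatiEnd (Ψ k) (h k).1 (h k).2.2 (hG k))) :
    lefschetzIdentityC Φ G₀ = lefschetzGroupC Φ G₀ :=
  (hX.lefschetzIdentityC_eq_lefschetzGroupC_iff_forall_not_isAlbertTypeIII_of_powers' hη hG₀ h hG hhom hn hs hg).2 hIII

/-- Every-`g` form along an explicit Albert sorting of the factors: `X ∼ ∏ B_k^{n_k}` with each `B_k` of type I,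
II, III or IV has `Lf(X)(ℂ) = S(X)(ℂ)` iff no `B_k` is of type III. [cite: Milne1999LefschetzClasses, §1 Prop. 1.5, §2 Summary table and Remark 4.9] -/
theorem IsIsogenous.lefschetzIdentityC_eq_lefschetzGroupC_iff_forall_not_isAlbertTypeIII_of_powers_of_isAlbertType
    (hX : IsIsogenous Φ (sigmaPiPeriod fun k ↦ powPeriod (Ψ k) (n k))) (hη : IsRiemannForm Φ η)
    (hG₀ : G₀.map (Rat.cast : ℚ → ℝ) = latticeGram Φ η) (h : ∀ k, IsRiemannForm (Ψ k) (ω k))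
    (hG : ∀ k, (G k).map (Rat.cast : ℚ → ℝ) = latticeGram (Ψ k) (ω k))
    (hhom : ∀ k l, k ≠ l → homRat (Ψ l) (Ψ k) = ⊥) (hn : ∀ k, 0 < n k) (hs : ∀ k, IsSimple (Ψ k))
    (htype : ∀ k, IsAlbertTypeI (centerField (Ψ k) (hs k)) (endAlgRat (Ψ k)) (rosatiEnd (Ψ k) (h k).1 (h k).2.2 (hG k)) ∨
      IsAlbertTypeII (centerField (Ψ k) (hs k)) (endAlgRat (Ψ k)) (rosatiEnd (Ψ k) (h k).1 (h k).2.2 (hG k)) ∨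
        IsAlbertTypeIII (centerField (Ψ k) (hs k)) (endAlgRat (Ψ k)) (rosatiEnd (Ψ k) (h k).1 (h k).2.2 (hG k)) ∨
          IsAlbertTypeIV (centerField (Ψ k) (hs k)) (endAlgRat (Ψ k)) (rosatiEnd (Ψ k) (h k).1 (h k).2.2 (hG k))) :
    lefschetzIdentityC Φ G₀ = lefschetzGroupC Φ G₀ ↔
      ∀ k, ¬ IsAlbertTypeIII (centerField (Ψ k) (hs k)) (endAlgRat (Ψ k)) (rosatiEnd (Ψ k) (h k).1 (h k).2.2 (hG k)) := by
  rw [hX.lefschetzIdentityC_eq_lefschetzGroupC_iff_of_powers hη hG₀ h hG hhom hn]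
  exact forall_congr' fun k ↦
    (hs k).lefschetzIdentityC_eq_lefschetzGroupC_iff_not_isAlbertTypeIII_of_isAlbertType (h k) (hG k) (htype k)

end IsogenyFactors

end ComplexTorus

end Literature.Geometry.Kaehler
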